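import Summits.ResolutionOfSingularities.ResolutionOfSingularities.Theorems.HomologicalConductorNoZenoRCriterionM
import Summits.ResolutionOfSingularities.ResolutionOfSingularities.Theorems.HomologicalConductorNoZenoExcDegreeOnePoint
import Literature.AlgebraicGeometry.Resolution.Lipman1969NegativeDefiniteHolds
import Literature.AlgebraicGeometry.Resolution.Lipman1969IntersectionMultipleHolds
import HarnessLib

/-!
# Crux `NoZenoR` (stmt-ResolutionOfSingularities-19943) — two DISTINCT integral exceptional curves OF THE FIRST KIND on a
# desingularization of a rational surface singularity are DISJOINT

Route `ResolutionOfSingularities/HomologicalConductor` (cell decomp-res, hand leafhand-res-homologicalconduct-18 g1).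
OURS: AI-written proof over tree theorems, weaker than expert review; nothing here is a statement of the manuscript
under review (Hironaka 2017).  SUPPORT level, counted 0.  Def-free, no new named facts (Lipman (13.1) a), (13.1) d),
(14.1) are tree theorems).

**`disjoint_closure_of_firstKind`** — `S` a two-dimensional Noetherian local normal domain with a rational singularity,
`π : X → Spec S` a desingularization, `η₁ ≠ η₂` integral exceptional curves of the first kind
(`h⁰(𝓘_η²) = 3·h⁰(𝓘_η)`, i.e. `(E·E) = −h⁰(E)`): then `cl{η₁} ∩ cl{η₂} = ∅`.  Proof: negative definiteness (14.1) of the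
intersection matrix of `{E₁, E₂}` tested on the vector `(1, 1)` gives `(E₁·E₁) + (E₂·E₁) + (E₁·E₂) + (E₂·E₂) < 0`; the
diagonal terms are `−h⁰(E₁)`, `−h⁰(E₂)` (first kind, via (13.1) d)); if the curves met, the off-diagonal terms would be
POSITIVE (`ExcCount.excCurveDegree_pos_of_mem_closure_inter`) multiples of `h⁰(E₁)`, `h⁰(E₂)` ((13.1) a)), hence
`≥ h⁰(E₁)`, `≥ h⁰(E₂)` — contradiction.  (Used to carry first-kind curves unchanged past the blow-downs of Zariski's
factorisation: a first-kind curve not contracted by a point blow-down misses its exceptional curve.)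

No crux or summit statement is proved here.
-/

noncomputable section

-- single-problem summit: the doubled namespace component `ResolutionOfSingularities` is forced
set_option linter.dupNamespace false

open CategoryTheory AlgebraicGeometry TopologicalSpace Topology IsLocalRing
open Literature.AlgebraicGeometry.Resolution Literature.AlgebraicGeometry.Motives
open Summit.ResolutionOfSingularities.ResolutionOfSingularities.Theorems.NoZeno.ExcCount

universe u

namespace Summit.ResolutionOfSingularities.ResolutionOfSingularities.Theorems.NoZeno.FirstKind

variable {S : Type u} [CommRing S] [IsNoetherianRing S] [IsLocalRing S] [IsDomain S] [IsIntegrallyClosed S]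
  {X : Scheme.{u}} {π : X ⟶ Spec (.of S)}

/-- **The self-intersection of a first-kind curve is `−h⁰`**: for `η ∈ excCurvePoints π` (desingularization of a
rational surface singularity) with `h⁰(𝓘_η²) = 3·h⁰(𝓘_η)`, `([E_η]·E_η) = −h⁰(𝓘_η).toNat` ((13.1) d) at `η = η′`).
[cite: Lipman1969, Proposition (13.1) d) (p. 223)] -/
theorem excCurveDegree_self_eq_neg_h0_of_firstKind (h2 : ringKrullDim S = 2) (hS : HasRationalSingularity S)
    (hπ : IsResolution π) [IsIntegral X] [IsLocallyNoetherian X] {η : X} (hη : η ∈ excCurvePoints π)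
    (hc : IsEffectiveCartier (primeDivisorIdeal η))
    (hfk : h0 π (primeDivisorIdeal η ^ 2) = 3 * h0 π (primeDivisorIdeal η)) :
    excCurveDegree π (CartierDivisor.ofIsEffectiveCartier (primeDivisorIdeal η) hc) η =
      -((h0 π (primeDivisorIdeal η)).toNat : ℤ) := by
  rw [Lipman12B.Lipman1969_13_1_d_rat_holds S h2 hS X π hπ η hη η hη hc, ← pow_two, hfk, ENat.toNat_mul]
  simp only [ENat.toNat_ofNat, Nat.cast_mul, Nat.cast_ofNat]
  ring

/-- **Distinct first-kind exceptional curves are disjoint.**  `S` a two-dimensional Noetherian local normal domain with a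
rational singularity, `π : X → Spec S` a desingularization, `η₁ ≠ η₂ ∈ excCurvePoints π` both of the first kind ⇒
`cl{η₁} ∩ cl{η₂} = ∅` (negative definiteness (14.1) on `(1,1)` against positivity (13.1) c) and integrality (13.1) a) of
the mutual intersection numbers). [cite: Lipman1969, Lemma (14.1) (p. 224) and Proposition (13.1) a), c), d) (p. 223)] -/
theorem disjoint_closure_of_firstKind (h2 : ringKrullDim S = 2) (hS : HasRationalSingularity S)
    (hπ : IsResolution π) {η₁ η₂ : X} (hη₁ : η₁ ∈ excCurvePoints π) (hη₂ : η₂ ∈ excCurvePoints π)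
    (hne : η₁ ≠ η₂) (hfk₁ : h0 π (primeDivisorIdeal η₁ ^ 2) = 3 * h0 π (primeDivisorIdeal η₁))
    (hfk₂ : h0 π (primeDivisorIdeal η₂ ^ 2) = 3 * h0 π (primeDivisorIdeal η₂)) :
    Disjoint (closure ({η₁} : Set X)) (closure {η₂}) := by
  classical
  haveI : IsIntegral X := hπ.isIntegral_source
  haveI : IsProper π := hπ.isProper
  haveI : IsLocallyNoetherian X := LocallyOfFiniteType.isLocallyNoetherian π
  have hX : Scheme.IsRegular X := hπ.isRegular
  have hcart : ∀ η ∈ excCurvePoints π, IsEffectiveCartier (primeDivisorIdeal η) := fun η hη =>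
    isEffectiveCartier_primeDivisorIdeal_of_isRegular hX (hπ.coheight_eq_one_of_mem_excCurvePoints h2 hη)
  rw [Set.disjoint_iff_inter_eq_empty]
  by_contra hmeet
  obtain ⟨x, hx⟩ := Set.nonempty_iff_ne_empty.mpr hmeet
  -- the Cartier divisors `[E_η]` as a function on `X` (zero off the exceptional curves)
  let D : X → CartierDivisor X := fun η =>
    if h : η ∈ excCurvePoints π then CartierDivisor.ofIsEffectiveCartier (primeDivisorIdeal η) (hcart η h) else 0
  have hD : ∀ {η} (h : η ∈ excCurvePoints π),
      D η = CartierDivisor.ofIsEffectiveCartier (primeDivisorIdeal η) (hcart η h) := fun h => dif_pos h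
  -- the four intersection numbers
  set e : X → X → ℤ := fun j i => excCurveDegree π (D j) i with he
  have h11 : e η₁ η₁ = -((h0 π (primeDivisorIdeal η₁)).toNat : ℤ) := by
    simp only [he, hD hη₁]
    exact excCurveDegree_self_eq_neg_h0_of_firstKind h2 hS hπ hη₁ _ hfk₁
  have h22 : e η₂ η₂ = -((h0 π (primeDivisorIdeal η₂)).toNat : ℤ) := by
    simp only [he, hD hη₂]
    exact excCurveDegree_self_eq_neg_h0_of_firstKind h2 hS hπ hη₂ _ hfk₂
  -- off-diagonal terms: positive multiples of `h⁰`
  have h21 : ((h0 π (primeDivisorIdeal η₁)).toNat : ℤ) ≤ e η₂ η₁ := by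
    simp only [he, hD hη₂]
    have hpos := excCurveDegree_pos_of_mem_closure_inter π hη₁ hη₂ hne hx (hcart η₂ hη₂)
    obtain ⟨m, hm⟩ := Lipman1969_13_1_a_holds S X π hπ.isProper hX
      (CartierDivisor.ofIsEffectiveCartier (primeDivisorIdeal η₂) (hcart η₂ hη₂)) η₁ hη₁
    rw [hm] at hpos ⊢
    have h0nn : (0 : ℤ) ≤ ((h0 π (primeDivisorIdeal η₁)).toNat : ℤ) := Nat.cast_nonneg _
    have hm1 : 1 ≤ m := by
      by_contra hm'
      push Not at hm'
      have : m * ((h0 π (primeDivisorIdeal η₁)).toNat : ℤ) ≤ 0 :=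
        mul_nonpos_of_nonpos_of_nonneg (by omega) h0nn
      omega
    nlinarith
  have h12 : ((h0 π (primeDivisorIdeal η₂)).toNat : ℤ) ≤ e η₁ η₂ := by
    simp only [he, hD hη₁]
    have hx' : x ∈ closure {η₂} ∩ closure {η₁} := ⟨hx.2, hx.1⟩
    have hpos := excCurveDegree_pos_of_mem_closure_inter π hη₂ hη₁ hne.symm hx' (hcart η₁ hη₁)
    obtain ⟨m, hm⟩ := Lipman1969_13_1_a_holds S X π hπ.isProper hX
      (CartierDivisor.ofIsEffectiveCartier (primeDivisorIdeal η₁) (hcart η₁ hη₁)) η₂ hη₂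
    rw [hm] at hpos ⊢
    have h0nn : (0 : ℤ) ≤ ((h0 π (primeDivisorIdeal η₂)).toNat : ℤ) := Nat.cast_nonneg _
    have hm1 : 1 ≤ m := by
      by_contra hm'
      push Not at hm'
      have : m * ((h0 π (primeDivisorIdeal η₂)).toNat : ℤ) ≤ 0 :=
        mul_nonpos_of_nonpos_of_nonneg (by omega) h0nn
      omega
    nlinarith
  -- negative definiteness on the vector `(1, 1)`
  let F : Finset X := {η₁, η₂}
  have hF : ∀ η ∈ F, η ∈ excCurvePoints π := fun η hη => by
    rcases Finset.mem_insert.mp hη with rfl | hη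
    · exact hη₁
    · rw [Finset.mem_singleton.mp hη]; exact hη₂
  have hneg := Lipman1969_14_1_holds S h2 X π hπ F hF (fun η hη => hcart η (hF η hη)) (fun _ => 1)
    (fun h0 => one_ne_zero (congr_fun h0 ⟨η₁, Finset.mem_insert_self η₁ _⟩))
  simp only [one_mul] at hneg
  -- rewrite the summand through `D` and expand the double sum over the pair
  have hsummand : ∀ (i j : {η // η ∈ F}),
      excCurveDegree π (CartierDivisor.ofIsEffectiveCartier (primeDivisorIdeal (j : X)) (hcart j (hF j j.2))) i =
        e j i := fun i j => by
    simp only [he, hD (hF j j.2)]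
  simp only [hsummand] at hneg
  have hinner : ∀ i : X, ∑ j : {η // η ∈ F}, e j i = e η₁ i + e η₂ i := fun i => by
    rw [Finset.sum_coe_sort F (fun j => e j i), Finset.sum_pair hne]
  have hexpand : ∑ i : {η // η ∈ F}, ∑ j : {η // η ∈ F}, e j i =
      e η₁ η₁ + e η₂ η₁ + (e η₁ η₂ + e η₂ η₂) := by
    simp_rw [hinner]
    rw [Finset.sum_coe_sort F (fun i => e η₁ i + e η₂ i), Finset.sum_pair hne]
  rw [hexpand] at hneg
  omega

end Summit.ResolutionOfSingularities.ResolutionOfSingularities.Theorems.NoZeno.FirstKind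

end
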